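import Summits.BirchSwinnertonDyer.BirchSwinnertonDyer.Theorems.PrintCFramBottomClassIndexLawFiveLeHerbrandUntwist
import Literature.NumberTheory.EllipticCurves.H1CorestrictionIndexTwo
import HarnessLib

/-!
# Crux `PrintCFram.BottomClassIndexLawFiveLe` (stmt-BirchSwinnertonDyer-20372), line `eisenstein-resource-bdp-line` (v10):
# Stub H, T4 step 1 in HOM FORM — over the splitting field the residual Selmer class is a CONTINUOUS HOMOMORPHISM
# `z : N_θ → Φ`, `θ`-equivariant, vanishing on the inertia groups off `S ∪ {p}` and on the decomposition group at `𝔭`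

Cell `bsd-print-cfram`, LEAD seat `bsd-line-cfram-p1` (generation g8), `--supports stmt-BirchSwinnertonDyer-20372` (helper).
THEOREMS ONLY; no definition, no named fact, no `sorry`. BSD is not proved by any of this; no summit statement is proved
by this seat.

WHAT. `…HerbrandUntwist` (p650708) reduced Stub H for a stable line `Φ` to: «every `Γ_K`-invariant class of the strict Selmer group
`datumStrictSelmer N Φ p (bdpData Φ p 𝔭) S` over the splitting field `K̄^N`, `N = ker(Γ_K → Aut Φ)`, is zero». Since `N` acts TRIVIALLY on
`Φ`, `H¹(N, Φ)` has no coboundaries: a class IS a continuous crossed = genuine homomorphism `z : N → Φ`; invariance under `conjH1 g` is the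
`θ`-equivariance `g · z(g⁻¹ n g) = z(n)`; for an invariant class the conjugates `σ` in the Greenberg–Vatsal conditions are redundant, so
«unramified off `S ∪ {p}`» is `z = 0` on `N ∩ I_v` and «strict for `bdpData … 𝔭`» is `z = 0` on `N ∩ D_𝔭` (the other primes above `p`
carry the relaxed datum, no condition). This file proves exactly that unpacking, generically, and restates Stub H's two conclusions as:

  **Stub H(Φ) ⟸ every continuous `θ`-equivariant homomorphism `N_θ → Φ` killing `N_θ ∩ I_v` (`v ∉ S`, `v ∤ p`) and `N_θ ∩ D_𝔭` is zero**
  (and the same for `W_K[p]/Φ`, `θ'`) — the statement «`Hom(Gal(M/L_θ), 𝔽_p)^{[θ]} = 0`» of M1 §2–3 with `M` the maximal abelian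
  exponent-`p` extension of `L_θ` unramified outside `S ∪ {𝔭̄}` and split at `𝔭`, now with NO cohomology left in it.

* §1 `oneCocycleClass_eq_zero_of_forall_eq_zero`, `apply_conj_eq_of_conjH1_eq` (invariance ⟹ equivariance),
  `apply_inertiaIn_eq_zero_of_mem_unramifiedKer`, `apply_decompIn_eq_zero_of_mem_strictKer_strictDatum` — cocycle readings for a
  subgroup `N` acting trivially on `M`.
* §2 `datumStrictSelmer_bdpData_eq_bot_of_forall_hom` — GENERIC: `K`, `M`, `N ≤ H = Γ_K` with `N` acting trivially, `res` injective.
* §3 `stubH_of_forall_hom_of_cmRamified` — on the class, Stub H's quantifiers (every quadratic `K`, every stable line of order `p`).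

References: Serre, *Galois Cohomology* I §2.3–2.6; Greenberg 1989 §1 (strict condition); Greenberg–Vatsal 2000 §2; Castella 2018 Def. 2.2
(the data `(∅, 0)` = strict at `𝔭`, relaxed at `𝔭̄`); the herbrand M1 memo §1–§3.
-/

noncomputable section

-- summit-side namespace `Summit.BirchSwinnertonDyer.BirchSwinnertonDyer.Theorems.…` (single-conjunct summit, D-0017 layout)
set_option linter.dupNamespace false
set_option autoImplicit false

open scoped Classical
open NumberField Field IsDedekindDomain
open Literature.NumberTheory.EllipticCurves Literature.NumberTheory.EllipticCurves.GreenbergSelmer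
  Literature.NumberTheory.EllipticCurves.GreenbergVatsal2000
  Literature.NumberTheory.EllipticCurves.Rank1Residual Literature.NumberTheory.GaloisRepresentations
open Summit.BirchSwinnertonDyer.Rank1Residual

namespace Summit.BirchSwinnertonDyer.BirchSwinnertonDyer.Theorems.PrintCFram.HerbrandUntwist

/-! ## §1 Cocycle readings for a subgroup acting trivially -/

section Readings

variable {K : Type} [Field K] [NumberField K]
  {M : Type} [AddCommGroup M] [DistribMulAction (absoluteGaloisGroup K) M] [TopologicalSpace M] [DiscreteTopology M]
  (N : Subgroup (absoluteGaloisGroup K))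

omit [NumberField K] in
/-- A cocycle that vanishes identically has the zero class. [cite: SerreGaloisCohomology1997, I.§2.3] -/
theorem oneCocycleClass_eq_zero_of_forall_eq_zero (z : contOneCocycles (discreteTopRep N M)) (hz : ∀ n : N, z.1 n = 0) :
    oneCocycleClass (discreteTopRep N M) z = 0 := by
  rw [oneCocycleClass_eq_zero_iff]
  refine ⟨0, fun n ↦ ?_⟩
  rw [hz n, map_zero, sub_zero]

omit [NumberField K] in
/-- **Invariance ⟹ equivariance.** If `N` acts trivially on `M` and the class of the cocycle `z : N → M` is fixed by `conjH1 N M g`, then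
`g · z(g⁻¹ n g) = z(n)` for all `n ∈ N` (the difference of the two cocycles is a coboundary, and coboundaries of a trivial module vanish).
[cite: SerreGaloisCohomology1997, I.§2.5 and I.§5.8 (a)] -/
theorem apply_conj_eq_of_conjH1_eq [N.Normal] (hN : ∀ n ∈ N, ∀ m : M, n • m = m)
    (z : contOneCocycles (discreteTopRep N M)) {g : absoluteGaloisGroup K}
    (hg : conjH1 N M g (oneCocycleClass (discreteTopRep N M) z) = oneCocycleClass (discreteTopRep N M) z) (n : N) :
    g • z.1 (subgroupConj N g n) = z.1 n := by
  rw [conjH1_oneCocycleClass, ← sub_eq_zero, ← oneCocycleClass_sub, oneCocycleClass_eq_zero_iff] at hg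
  obtain ⟨a, ha⟩ := hg
  have h := ha n
  rw [sub_apply_val, conjCocycle_apply] at h
  have htriv : (discreteTopRep N M).ρ n a = a := hN n n.2 a
  rw [htriv, sub_self, sub_eq_zero] at h
  exact h

/-- **Unramified at `v` ⟹ `z = 0` on `N ∩ I_v`** (for `N` acting trivially). [cite: GreenbergVatsal2000, §2 p. 17] -/
theorem apply_inertiaIn_eq_zero_of_mem_unramifiedKer (hN : ∀ n ∈ N, ∀ m : M, n • m = m)
    (z : contOneCocycles (discreteTopRep N M)) {v : HeightOneSpectrum (𝓞 K)}
    (hz : oneCocycleClass (discreteTopRep N M) z ∈ unramifiedKer N M v) (x : inertiaIn N v) :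
    z.1 (inertiaInToH N v x) = 0 := by
  rw [ResidualLayer.oneCocycleClass_mem_unramifiedKer_iff] at hz
  obtain ⟨m, hm⟩ := hz
  have h := hm x
  have hxN : ((x : decomp (K := K) v) : absoluteGaloisGroup K) ∈ N := ((mem_inertiaIn_iff N v x).1 x.2).1
  have htriv : x • m = m := hN _ hxN m
  rw [htriv, sub_self] at h
  exact h

/-- **Strict at `v` for the STRICT datum (`M⁺_v = 0`) ⟹ `z = 0` on `N ∩ D_v`** (for `N` acting trivially: the witness of the
coboundary in `M/0` is fixed by `N ∩ D_v`, and `M → M/0` has trivial kernel). [cite: Greenberg1989, §1 p. 98]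
[cite: Castella2018, Def. 2.2 (arXiv:1704.06608 p. 5)] -/
theorem apply_decompIn_eq_zero_of_mem_strictKer_strictDatum (hN : ∀ n ∈ N, ∀ m : M, n • m = m)
    (z : contOneCocycles (discreteTopRep N M)) {v : HeightOneSpectrum (𝓞 K)}
    (hz : oneCocycleClass (discreteTopRep N M) z ∈ (X11b.AcSelmer.strictDatum M v).strictKer N) (x : decompIn N v) :
    z.1 (decompInToH N v x) = 0 := by
  rw [LocalDatum.mem_strictKer_iff, LocalDatum.strictMap, CocycleCriteria.resH1Hom_oneCocycleClass_eq_zero_iff] at hz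
  obtain ⟨a, ha⟩ := hz
  obtain ⟨a₀, rfl⟩ := (X11b.AcSelmer.strictDatum M v).grMk_surjective a
  have h := ha x
  have hxN : ((x : decomp (K := K) v) : absoluteGaloisGroup K) ∈ N := (mem_decompIn_iff N v x).1 x.2
  have htriv : x • (X11b.AcSelmer.strictDatum M v).grMk a₀ = (X11b.AcSelmer.strictDatum M v).grMk a₀ := by
    change (x : decomp (K := K) v) • (X11b.AcSelmer.strictDatum M v).grMk a₀ = _
    rw [LocalDatum.smul_grMk, hN _ hxN a₀]
  rw [htriv, sub_self, ← AddMonoidHom.mem_ker, LocalDatum.ker_grMk] at h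
  change z.1 (decompInToH N v x) ∈ (⊥ : AddSubgroup M) at h
  exact (AddSubgroup.mem_bot).mp h

end Readings

/-! ## §2 The untwisted statement in Hom form (generic) -/

section HomForm

variable {K : Type} [Field K] [NumberField K]
  {M : Type} [AddCommGroup M] [DistribMulAction (absoluteGaloisGroup K) M] [TopologicalSpace M] [DiscreteTopology M]

/-- **Castella's strict Selmer group over the bottom layer vanishes from a statement about HOMOMORPHISMS of the splitting group.**
Let `N ≤ H` be normal subgroups of `Γ_K` with `H ⊇ Γ_K` and `N` acting trivially on `M`, `res : H¹(H,M) → H¹(N,M)` injective, `p` a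
prime, `𝔭 ∋ p`, `S₀` a set of places. If every continuous cocycle (= homomorphism) `z : N → M` which is `Γ_K`-equivariant
(`g · z(g⁻¹ n g) = z(n)`), vanishes on `N ∩ I_v` for every `v ∉ S₀` with `v ∤ p`, and vanishes on `N ∩ D_𝔭`, is identically zero, then
`datumStrictSelmer H M p (bdpData M p 𝔭) S₀ = ⊥`. [cite: GreenbergVatsal2000, §2 pp. 16–17, 20] [cite: Castella2018, Def. 2.2 (arXiv:1704.06608 p. 5)]
[cite: SerreGaloisCohomology1997, I.§2.6 (b)] -/
theorem datumStrictSelmer_bdpData_eq_bot_of_forall_hom {N H : Subgroup (absoluteGaloisGroup K)} [N.Normal] [H.Normal]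
    (hNH : N ≤ H) (hH : ∀ g : absoluteGaloisGroup K, g ∈ H) (hN : ∀ n ∈ N, ∀ m : M, n • m = m)
    (p : ℕ) (𝔭 : HeightOneSpectrum (𝓞 K)) (h𝔭 : ((p : ℕ) : 𝓞 K) ∈ 𝔭.asIdeal) (S₀ : Set (HeightOneSpectrum (𝓞 K)))
    (hinj : Function.Injective (resOfLe M hNH))
    (hz : ∀ z : contOneCocycles (discreteTopRep N M),
      (∀ (g : absoluteGaloisGroup K) (n : N), g • z.1 (subgroupConj N g n) = z.1 n) →
      (∀ v : HeightOneSpectrum (𝓞 K), v ∉ S₀ → ((p : ℕ) : 𝓞 K) ∉ v.asIdeal →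
        ∀ x : inertiaIn N v, z.1 (inertiaInToH N v x) = 0) →
      (∀ x : decompIn N 𝔭, z.1 (decompInToH N 𝔭 x) = 0) →
      ∀ n : N, z.1 n = 0) :
    datumStrictSelmer H M p (X11b.AcSelmer.bdpData M p 𝔭) S₀ = ⊥ := by
  refine datumStrictSelmer_eq_bot_of_forall_invariant_eq_zero hNH hH p _ S₀ hinj fun x hx hinv ↦ ?_
  obtain ⟨z, rfl⟩ := oneCocycleClass_surjective _ x
  rw [mem_datumStrictSelmer_iff] at hx
  obtain ⟨hunr, hstr⟩ := hx
  refine oneCocycleClass_eq_zero_of_forall_eq_zero N z (hz z (fun g n ↦ ?_) (fun v hv hpv y ↦ ?_) (fun y ↦ ?_))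
  · exact apply_conj_eq_of_conjH1_eq N hN z (hinv g) n
  · -- unramified at `v`: the conjugate by `σ = 1` is the class itself
    have h1 := (mem_unramifiedOutside_iff _).1 hunr v hv hpv 1
    rw [conjH1_one_holds N M, AddMonoidHom.id_apply] at h1
    exact apply_inertiaIn_eq_zero_of_mem_unramifiedKer N hN z h1 y
  · -- strict at `𝔭` for Castella's data: the strict datum
    have h1 := hstr 𝔭 h𝔭 1
    rw [conjH1_one_holds N M, AddMonoidHom.id_apply, X11b.AcSelmer.bdpData_self] at h1
    exact apply_decompIn_eq_zero_of_mem_strictKer_strictDatum N hN z h1 y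

end HomForm

/-! ## §3 On the class, with Stub H's quantifiers -/

section Class

variable {p : ℕ} [hp : Fact p.Prime]

/-- **Stub H ⟸ the two Hom-form statements (every quadratic `K`, every stable line of order `p`).** For `W/ℚ` CM, `p ≥ 5` CM-ramified,
a quadratic `K`, `κ`, `𝔭 ∋ p`, `S`, and a `Γ_K`-stable `Φ ≤ W_K[p]` with `#Φ = p`; `N_S = ker(Γ_K → Aut Φ)`, `N_Q = ker(Γ_K → Aut(W_K[p]/Φ))`.
If every continuous `Γ_K`-equivariant homomorphism `N_S → Φ` vanishing on `N_S ∩ I_v` (`v ∉ S`, `v ∤ p`) and on `N_S ∩ D_𝔭` is zero, and the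
same for `N_Q → W_K[p]/Φ`, then both bottom-layer residual Selmer groups of Stub H vanish for `Φ`. This is M1 §2–3's
«`Hom(Gal(M/L_θ), 𝔽_p)^{[θ]} = 0` and `Hom(Gal(M'/L_{θ'}), 𝔽_p)^{[θ']} = 0`» as the EXACT remaining obligation, cohomology-free.
[cite: GreenbergVatsal2000, §2 p. 28] [cite: GreenbergLNM1716, §3 (PDF p. 86)] [cite: Castella2018, Def. 2.2 (arXiv:1704.06608 p. 5)] -/
theorem stubH_of_forall_hom_of_cmRamified (W : WeierstrassCurve ℚ) [W.IsElliptic] (hCM : W.HasCM)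
    (hram : CMRamified W p) (h5 : 5 ≤ p) (K : Type) [Field K] [NumberField K] (hK2 : Module.finrank ℚ K = 2)
    (κ : ZpExtension K p) (𝔭 : HeightOneSpectrum (𝓞 K)) (h𝔭 : ((p : ℕ) : 𝓞 K) ∈ 𝔭.asIdeal)
    (S : Set (HeightOneSpectrum (𝓞 K)))
    (Φ : X2.ResidualDevissageModules.StableSubgroup (absoluteGaloisGroup K) ((W.baseChange K).geomTorsion (p : ℤ)))
    (hcard : Nat.card Φ.Sub = p)
    (hS : ∀ z : contOneCocycles (discreteTopRep (MulAction.toPermHom (absoluteGaloisGroup K) Φ.Sub).ker Φ.Sub),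
      (∀ (g : absoluteGaloisGroup K) (n : (MulAction.toPermHom (absoluteGaloisGroup K) Φ.Sub).ker),
        g • z.1 (subgroupConj _ g n) = z.1 n) →
      (∀ v : HeightOneSpectrum (𝓞 K), v ∉ S → ((p : ℕ) : 𝓞 K) ∉ v.asIdeal →
        ∀ x : inertiaIn (MulAction.toPermHom (absoluteGaloisGroup K) Φ.Sub).ker v, z.1 (inertiaInToH _ v x) = 0) →
      (∀ x : decompIn (MulAction.toPermHom (absoluteGaloisGroup K) Φ.Sub).ker 𝔭, z.1 (decompInToH _ 𝔭 x) = 0) →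
      ∀ n, z.1 n = 0)
    (hQ : ∀ z : contOneCocycles (discreteTopRep (MulAction.toPermHom (absoluteGaloisGroup K) Φ.Quot).ker Φ.Quot),
      (∀ (g : absoluteGaloisGroup K) (n : (MulAction.toPermHom (absoluteGaloisGroup K) Φ.Quot).ker),
        g • z.1 (subgroupConj _ g n) = z.1 n) →
      (∀ v : HeightOneSpectrum (𝓞 K), v ∉ S → ((p : ℕ) : 𝓞 K) ∉ v.asIdeal →
        ∀ x : inertiaIn (MulAction.toPermHom (absoluteGaloisGroup K) Φ.Quot).ker v, z.1 (inertiaInToH _ v x) = 0) →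
      (∀ x : decompIn (MulAction.toPermHom (absoluteGaloisGroup K) Φ.Quot).ker 𝔭, z.1 (decompInToH _ 𝔭 x) = 0) →
      ∀ n, z.1 n = 0) :
    datumStrictSelmer (κ.layerSubgroup 0) Φ.Sub p (X11b.AcSelmer.bdpData Φ.Sub p 𝔭) S = ⊥ ∧
      datumStrictSelmer (κ.layerSubgroup 0) Φ.Quot p (X11b.AcSelmer.bdpData Φ.Quot p 𝔭) S = ⊥ := by
  have hH : ∀ g : absoluteGaloisGroup K, g ∈ κ.layerSubgroup 0 := fun g ↦ by
    rw [ZpExtension.layerSubgroup_zero]; exact Subgroup.mem_top g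
  obtain ⟨hbS, hbQ⟩ := HerbrandLineRestriction.subgroupResKer_ker_eq_bot_of_cmRamified W hCM hram h5 K hK2 Φ hcard
  have hNS : (MulAction.toPermHom (absoluteGaloisGroup K) Φ.Sub).ker ≤ κ.layerSubgroup 0 := fun g _ ↦ hH g
  have hNQ : (MulAction.toPermHom (absoluteGaloisGroup K) Φ.Quot).ker ≤ κ.layerSubgroup 0 := fun g _ ↦ hH g
  have htS : ∀ n ∈ (MulAction.toPermHom (absoluteGaloisGroup K) Φ.Sub).ker, ∀ m : Φ.Sub, n • m = m :=
    fun n hn m ↦ (HerbrandLineRestriction.mem_ker_toPermHom_iff n).1 hn m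
  have htQ : ∀ n ∈ (MulAction.toPermHom (absoluteGaloisGroup K) Φ.Quot).ker, ∀ m : Φ.Quot, n • m = m :=
    fun n hn m ↦ (HerbrandLineRestriction.mem_ker_toPermHom_iff n).1 hn m
  exact ⟨datumStrictSelmer_bdpData_eq_bot_of_forall_hom hNS hH htS p 𝔭 h𝔭 S
      (resOfLe_injective_of_subgroupResKer_eq_bot hNS hH hbS) hS,
    datumStrictSelmer_bdpData_eq_bot_of_forall_hom hNQ hH htQ p 𝔭 h𝔭 S
      (resOfLe_injective_of_subgroupResKer_eq_bot hNQ hH hbQ) hQ⟩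

end Class

end Summit.BirchSwinnertonDyer.BirchSwinnertonDyer.Theorems.PrintCFram.HerbrandUntwist

end
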